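import Summits.Ventures.Crystal3D.Theorems.StickyWulffConstantGenericWallFloorChainLedgerAntipodal
import Summits.Ventures.Crystal3D.Theorems.StickyWulffConstantGenericWallFloorInteriorCreditLedger
import Summits.Ventures.Crystal3D.Theorems.StickyWulffConstantGenericWallFloorExitWindow
import HarnessLib

/-!
# N-TC without the clean-sliver hypotheses: the chain ledger in EXACTLY the hypothesis shape of
# `stub_twoSlabAdhesion` (crux `GenericWallFloor`, line `WallLedgerG`)

HONEST FRAMING. Part of the venture `Summits/Ventures/Crystal3D` (cell `crystal3d-full`), helper
`--supports` the crux `GenericWallFloor` (stmt-Ventures-19480) of `route-Ventures-StickyWulffConstant`,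
registered line `WallLedgerG`, open stub `stub_twoSlabAdhesion`.  Sequel of `…ChainLedgerAntipodal`: the
same chain ledger (`twoSlabAdhesion_chainLedger'`: full charge `½(κ₁+κ₂) ≥ 1`, inputs `ExactOnly`(C12-55),
residuals `#TC₁ + #TC₂` and the degree-11 coincidence double tops `#DT₁₁`) but WITHOUT the two
«clean outer slivers» hypotheses, i.e. with the cell hypotheses of `TwoSlabAdhesion` VERBATIM.

Mechanism: the bookkeeping runs on the weighted INTERIOR ledger `ledger_ge_faces_add_interior_credits`
(…InteriorCreditLedger, after 19481-p2's `ledger_ge_faces_add_interior`: payers = all unsaturated balls at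
heights `[−R₀−2, h+R₀+2]`, sealing instead of clean slivers), and the lattice exits counted by
`card_lattice_exits_ge_window` are shown to lie in that height window unless they are RIM balls
(lateral radius `> ρ − 3`, `O((1+h)ρ)` of them, `card_mul_le_of_separated_in_shell`):
`lowExit_rim` — an exit below `−R₀ − 2` off the rim would have its missing slot inside the complete bottom
sample; `highExit_rim` — an exit above `h + R₀ + 2` off the rim has its full-shell predecessor and all
twelve slot neighbours sealed onto `Λ₂` (`sealing_below`/`sealing_above`), so `A₁·Λ₀ = A₂·Λ₀`
(`linear_eq_of_slots_on_affine`), excluded by the slot-set hypothesis.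

WHAT THIS IS NOT: not the stub (`ExactOnly` C12-55 and the residuals `#TC`, `#DT₁₁` remain); F-C1 not
moved.
-/

noncomputable section

namespace Summit.Ventures.Crystal3D.Theorems

open Summit.Ventures.Crystal3D Finset
open Literature.MathematicalPhysics.StatisticalMechanics (fccStacking contactDeficiency)
open scoped InnerProductSpace

open scoped Classical in
/-- **The chain ledger, sealed (no clean-sliver hypotheses).**  See the module docstring. -/
theorem twoSlabAdhesion_chainLedger_sealed
    {s₀ : EuclideanSpace ℝ (Fin 3)} (hs₀ : s₀ ∈ fccSlots)
    (hcert : ExactOnly 0 (fccSlots.filter fun w => 0 < ⟪w, s₀⟫_ℝ))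
    (A₁ : EuclideanSpace ℝ (Fin 3) ≃ₗᵢ[ℝ] EuclideanSpace ℝ (Fin 3)) (t₁ : EuclideanSpace ℝ (Fin 3))
    (A₂ : EuclideanSpace ℝ (Fin 3) ≃ₗᵢ[ℝ] EuclideanSpace ℝ (Fin 3)) (t₂ : EuclideanSpace ℝ (Fin 3))
    (hA₁₂ : ¬ ∀ w ∈ fccSlots, A₁ w ∈ A₂ '' fccStacking 1 (Real.sqrt (2 / 3)))
    (hA₂₁ : ¬ ∀ w ∈ fccSlots, A₂ w ∈ A₁ '' fccStacking 1 (Real.sqrt (2 / 3)))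
    {u₁ : EuclideanSpace ℝ (Fin 3)} (hu₁ : u₁ ∈ fccSlots)
    (hsteep₁ : Real.sqrt 2 / 2 ≤ ⟪A₁ u₁, EuclideanSpace.single (2 : Fin 3) (1 : ℝ)⟫_ℝ)
    {u₂ : EuclideanSpace ℝ (Fin 3)} (hu₂ : u₂ ∈ fccSlots)
    (hsteep₂ : ⟪A₂ u₂, EuclideanSpace.single (2 : Fin 3) (1 : ℝ)⟫_ℝ ≤ -(Real.sqrt 2 / 2)) :
    ∃ C R₀ : ℝ, 1 ≤ R₀ ∧ ∀ h : ℝ, 0 ≤ h → ∀ ρ : ℝ, R₀ ≤ ρ →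
      ∀ X P₁ P₂ : Finset (EuclideanSpace ℝ (Fin 3)),
      (∀ p ∈ X, ∀ q ∈ X, p ≠ q → 1 ≤ dist p q) → P₁ ⊆ X → P₂ ⊆ X \ P₁ →
      (∀ p ∈ X, -(2 * R₀) ≤ p 2 ∧ p 2 ≤ h + 2 * R₀ ∧ p 0 ^ 2 + p 1 ^ 2 ≤ ρ ^ 2) →
      (∀ p, p ∈ P₁ ↔ (p ∈ (fun q => A₁ q + t₁) '' fccStacking 1 (Real.sqrt (2 / 3)) ∧
        -(2 * R₀) ≤ p 2 ∧ p 2 ≤ -R₀ ∧ p 0 ^ 2 + p 1 ^ 2 ≤ ρ ^ 2)) →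
      (∀ p, p ∈ P₂ ↔ (p ∈ (fun q => A₂ q + t₂) '' fccStacking 1 (Real.sqrt (2 / 3)) ∧
        h + R₀ ≤ p 2 ∧ p 2 ≤ h + 2 * R₀ ∧ p 0 ^ 2 + p 1 ^ 2 ≤ ρ ^ 2)) →
      ((((P₁ ×ˢ (X \ P₁)).filter fun pq => dist pq.1 pq.2 = 1).card : ℕ) : ℝ) +
        ((((P₂ ×ˢ ((X \ P₁) \ P₂)).filter fun pq => dist pq.1 pq.2 = 1).card : ℕ) : ℝ) ≤
        contactDeficiency ((X \ P₁) \ P₂) +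
          (Real.sqrt 2 / 4 * ∑ᶠ w ∈ {w ∈ fccStacking 1 (Real.sqrt (2 / 3)) | ‖w‖ = 1},
              |⟪w, A₁.symm (EuclideanSpace.single (2 : Fin 3) (1 : ℝ))⟫_ℝ| +
            Real.sqrt 2 / 4 * ∑ᶠ w ∈ {w ∈ fccStacking 1 (Real.sqrt (2 / 3)) | ‖w‖ = 1},
              |⟪w, A₂.symm (EuclideanSpace.single (2 : Fin 3) (1 : ℝ))⟫_ℝ| -
            (Real.sqrt 2 * |⟪A₁ u₁, EuclideanSpace.single (2 : Fin 3) (1 : ℝ)⟫_ℝ| +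
              Real.sqrt 2 * |⟪A₂ u₂, EuclideanSpace.single (2 : Fin 3) (1 : ℝ)⟫_ℝ|) / 2) * Real.pi * ρ ^ 2 +
          (((((X.filter fun e => e ∈ (fun q => A₁ q + t₁) '' fccStacking 1 (Real.sqrt (2 / 3)) ∧
                e - A₁ u₁ ∈ X ∧ (∀ w ∈ fccSlots, e - A₁ u₁ + A₁ w ∈ X) ∧
                ∃ v ∈ fccSlots, e + A₁ v ∉ X).filter fun e => ∃ n : EuclideanSpace ℝ (Fin 3), ‖n‖ = 1 ∧
              (∀ w ∈ fccSlots, ⟪A₁ w, n⟫_ℝ = 0 ∨ ⟪A₁ w, n⟫_ℝ = Real.sqrt (2 / 3) ∨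
                ⟪A₁ w, n⟫_ℝ = -Real.sqrt (2 / 3)) ∧
              ⟪A₁ u₁, n⟫_ℝ = Real.sqrt (2 / 3) ∧
              (∀ w ∈ fccSlots, ⟪A₁ w, n⟫_ℝ ≤ 0 → e + A₁ w ∈ X) ∧
              (∀ w ∈ fccSlots, 0 < ⟪A₁ w, n⟫_ℝ → e + A₁ w ∉ X ∧ e - A₁ w + (2 * ⟪A₁ w, n⟫_ℝ) • n ∈ X)).card
              : ℕ) : ℝ) +
           ((((X.filter fun e => e ∈ (fun q => A₂ q + t₂) '' fccStacking 1 (Real.sqrt (2 / 3)) ∧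
                e - A₂ u₂ ∈ X ∧ (∀ w ∈ fccSlots, e - A₂ u₂ + A₂ w ∈ X) ∧
                ∃ v ∈ fccSlots, e + A₂ v ∉ X).filter fun e => ∃ n : EuclideanSpace ℝ (Fin 3), ‖n‖ = 1 ∧
              (∀ w ∈ fccSlots, ⟪A₂ w, n⟫_ℝ = 0 ∨ ⟪A₂ w, n⟫_ℝ = Real.sqrt (2 / 3) ∨
                ⟪A₂ w, n⟫_ℝ = -Real.sqrt (2 / 3)) ∧
              ⟪A₂ u₂, n⟫_ℝ = Real.sqrt (2 / 3) ∧
              (∀ w ∈ fccSlots, ⟪A₂ w, n⟫_ℝ ≤ 0 → e + A₂ w ∈ X) ∧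
              (∀ w ∈ fccSlots, 0 < ⟪A₂ w, n⟫_ℝ → e + A₂ w ∉ X ∧ e - A₂ w + (2 * ⟪A₂ w, n⟫_ℝ) • n ∈ X)).card
              : ℕ) : ℝ) +
           (((X.filter fun e => e ∈ (fun q => A₁ q + t₁) '' fccStacking 1 (Real.sqrt (2 / 3)) ∧
                e ∈ (fun q => A₂ q + t₂) '' fccStacking 1 (Real.sqrt (2 / 3)) ∧
                (X.filter fun q => dist e q = 1).card = 11 ∧
                (e - A₁ u₁ ∈ X ∧ (∀ w ∈ fccSlots, e - A₁ u₁ + A₁ w ∈ X) ∧ ∃ v ∈ fccSlots, e + A₁ v ∉ X) ∧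
                (e - A₂ u₂ ∈ X ∧ (∀ w ∈ fccSlots, e - A₂ u₂ + A₂ w ∈ X) ∧ ∃ v ∈ fccSlots, e + A₂ v ∉ X)).card
              : ℕ) : ℝ)) / 2 +
          C * (1 + h) * ρ := by
  obtain ⟨C₁, hC₁⟩ := affineSampleDeficit_upper A₁ t₁ 10 (by norm_num)
  obtain ⟨C₂, hC₂⟩ := affineSampleDeficit_upper A₂ t₂ 10 (by norm_num)
  refine ⟨(240 * Real.sqrt 2 * Real.pi + 4440 * (4 * 10 + 2)) / 2 + 100 + 60 * (4 * 10 + 2) + |C₁| + |C₂|,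
    10, by norm_num, ?_⟩
  intro h hh ρ hρ X P₁ P₂ hX hP₁X hP₂X hcell hP₁ hP₂
  set e₃ : EuclideanSpace ℝ (Fin 3) := EuclideanSpace.single (2 : Fin 3) (1 : ℝ) with he₃
  set φ₁ : ℝ := Real.sqrt 2 / 4 * ∑ᶠ w ∈ {w ∈ fccStacking 1 (Real.sqrt (2 / 3)) | ‖w‖ = 1},
      |⟪w, A₁.symm e₃⟫_ℝ| with hφ₁
  set φ₂ : ℝ := Real.sqrt 2 / 4 * ∑ᶠ w ∈ {w ∈ fccStacking 1 (Real.sqrt (2 / 3)) | ‖w‖ = 1},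
      |⟪w, A₂.symm e₃⟫_ℝ| with hφ₂
  set Λ₁ : Set (EuclideanSpace ℝ (Fin 3)) := (fun q => A₁ q + t₁) '' fccStacking 1 (Real.sqrt (2 / 3)) with hΛ₁
  set Λ₂ : Set (EuclideanSpace ℝ (Fin 3)) := (fun q => A₂ q + t₂) '' fccStacking 1 (Real.sqrt (2 / 3)) with hΛ₂
  have hP₂X' : P₂ ⊆ X := hP₂X.trans Finset.sdiff_subset
  have hρ0 : (0 : ℝ) ≤ ρ := by linarith
  -- the exit predicates and the sets of the statement
  set EX₁ : EuclideanSpace ℝ (Fin 3) → Prop := fun e =>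
    e - A₁ u₁ ∈ X ∧ (∀ w ∈ fccSlots, e - A₁ u₁ + A₁ w ∈ X) ∧ ∃ v ∈ fccSlots, e + A₁ v ∉ X with hEX₁
  set EX₂ : EuclideanSpace ℝ (Fin 3) → Prop := fun e =>
    e - A₂ u₂ ∈ X ∧ (∀ w ∈ fccSlots, e - A₂ u₂ + A₂ w ∈ X) ∧ ∃ v ∈ fccSlots, e + A₂ v ∉ X with hEX₂
  set TW₁ : EuclideanSpace ℝ (Fin 3) → Prop := fun e => ∃ n : EuclideanSpace ℝ (Fin 3), ‖n‖ = 1 ∧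
    (∀ w ∈ fccSlots, ⟪A₁ w, n⟫_ℝ = 0 ∨ ⟪A₁ w, n⟫_ℝ = Real.sqrt (2 / 3) ∨ ⟪A₁ w, n⟫_ℝ = -Real.sqrt (2 / 3)) ∧
    ⟪A₁ u₁, n⟫_ℝ = Real.sqrt (2 / 3) ∧ (∀ w ∈ fccSlots, ⟪A₁ w, n⟫_ℝ ≤ 0 → e + A₁ w ∈ X) ∧
    (∀ w ∈ fccSlots, 0 < ⟪A₁ w, n⟫_ℝ → e + A₁ w ∉ X ∧ e - A₁ w + (2 * ⟪A₁ w, n⟫_ℝ) • n ∈ X) with hTW₁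
  set TW₂ : EuclideanSpace ℝ (Fin 3) → Prop := fun e => ∃ n : EuclideanSpace ℝ (Fin 3), ‖n‖ = 1 ∧
    (∀ w ∈ fccSlots, ⟪A₂ w, n⟫_ℝ = 0 ∨ ⟪A₂ w, n⟫_ℝ = Real.sqrt (2 / 3) ∨ ⟪A₂ w, n⟫_ℝ = -Real.sqrt (2 / 3)) ∧
    ⟪A₂ u₂, n⟫_ℝ = Real.sqrt (2 / 3) ∧ (∀ w ∈ fccSlots, ⟪A₂ w, n⟫_ℝ ≤ 0 → e + A₂ w ∈ X) ∧
    (∀ w ∈ fccSlots, 0 < ⟪A₂ w, n⟫_ℝ → e + A₂ w ∉ X ∧ e - A₂ w + (2 * ⟪A₂ w, n⟫_ℝ) • n ∈ X) with hTW₂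
  set deg : EuclideanSpace ℝ (Fin 3) → ℕ := fun x => (X.filter fun q => dist x q = 1).card with hdeg
  set LEX₁ := X.filter fun e => e ∈ Λ₁ ∧ EX₁ e with hLEX₁
  set LEX₂ := X.filter fun e => e ∈ Λ₂ ∧ EX₂ e with hLEX₂
  set TC₁ := LEX₁.filter fun e => TW₁ e with hTC₁
  set TC₂ := LEX₂.filter fun e => TW₂ e with hTC₂
  set DT := X.filter fun e => e ∈ Λ₁ ∧ e ∈ Λ₂ ∧ deg e = 11 ∧ EX₁ e ∧ EX₂ e with hDT
  set W : EuclideanSpace ℝ (Fin 3) → Prop := fun y => -10 - 2 ≤ y 2 ∧ y 2 ≤ h + 10 + 2 with hW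
  set U₁ := LEX₁.filter fun e => deg e ≠ 12 ∧ W e with hU₁
  set U₂ := LEX₂.filter fun e => deg e ≠ 12 ∧ W e with hU₂
  set Rim₃ := X.filter fun x => (ρ - 3) ^ 2 < x 0 ^ 2 + x 1 ^ 2 with hRim₃
  -- the weighted interior ledger
  have hled := ledger_ge_faces_add_interior_credits A₁ t₁ A₂ t₂ X P₁ P₂ 10 h ρ le_rfl hh hρ hX hcell hP₁X hP₂X'
    hP₁ hP₂
  rw [← finsum_unit_fcc_symm_eq_sum_slots A₁, ← finsum_unit_fcc_symm_eq_sum_slots A₂, ← hφ₁, ← hφ₂] at hled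
  set PAY := X.filter fun y => (X.filter fun q => dist y q = 1).card ≠ 12 ∧
    -10 - 2 ≤ y 2 ∧ y 2 ≤ h + 10 + 2 with hPAY
  have hU₁P : U₁ ⊆ PAY := by
    intro y hy
    rw [hU₁, mem_filter, hLEX₁, mem_filter] at hy
    obtain ⟨⟨hyX, -, -⟩, hyd, hyW⟩ := hy
    rw [hPAY, mem_filter]
    exact ⟨hyX, hyd, hyW.1, hyW.2⟩
  have hU₂P : U₂ ⊆ PAY := by
    intro y hy
    rw [hU₂, mem_filter, hLEX₂, mem_filter] at hy
    obtain ⟨⟨hyX, -, -⟩, hyd, hyW⟩ := hy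
    rw [hPAY, mem_filter]
    exact ⟨hyX, hyd, hyW.1, hyW.2⟩
  have hdeg12 : ∀ x, deg x ≤ 12 := fun x => card_filter_dist_eq_one_le_twelve X hX x
  -- the weighted payer sum dominates `#U₁ + #U₂ − #DT`
  have hUU : ∀ y ∈ U₁ ∩ U₂, deg y = 11 → y ∈ DT := by
    intro y hy h11
    have hy₁ : y ∈ U₁ := (mem_inter.1 hy).1
    have hy₂ : y ∈ U₂ := (mem_inter.1 hy).2
    rw [hU₁, mem_filter, hLEX₁, mem_filter] at hy₁
    rw [hU₂, mem_filter, hLEX₂, mem_filter] at hy₂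
    obtain ⟨⟨hyX, hyΛ₁, hyE₁⟩, -⟩ := hy₁
    obtain ⟨⟨-, hyΛ₂, hyE₂⟩, -⟩ := hy₂
    rw [hDT, mem_filter]
    exact ⟨hyX, hyΛ₁, hyΛ₂, h11, hyE₁, hyE₂⟩
  have hPAYge : (U₁.card : ℝ) + U₂.card - DT.card ≤
      ∑ y ∈ PAY, ((12 : ℝ) - ((X.filter fun q => dist y q = 1).card : ℝ)) := by
    show (U₁.card : ℝ) + U₂.card - DT.card ≤ ∑ y ∈ PAY, ((12 : ℝ) - (deg y : ℝ))
    have hpt : ∀ y ∈ U₁ ∪ U₂, ((if y ∈ U₁ then (1 : ℝ) else 0) + (if y ∈ U₂ then (1 : ℝ) else 0) -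
        (if y ∈ DT then (1 : ℝ) else 0)) ≤ (12 : ℝ) - (deg y : ℝ) := by
      intro y hy
      have hne : deg y ≠ 12 := by
        rcases mem_union.1 hy with h' | h'
        · exact (mem_filter.1 h').2.1
        · exact (mem_filter.1 h').2.1
      have hle : deg y ≤ 11 := by have := hdeg12 y; omega
      have h11r : (deg y : ℝ) ≤ 11 := by exact_mod_cast hle
      by_cases hb : y ∈ U₁ ∧ y ∈ U₂
      · rw [if_pos hb.1, if_pos hb.2]
        by_cases h11 : deg y = 11
        · rw [if_pos (hUU y (mem_inter.2 hb) h11), h11]; norm_num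
        · have : (deg y : ℝ) ≤ 10 := by exact_mod_cast (by omega : deg y ≤ 10)
          have h0 : (0 : ℝ) ≤ (if y ∈ DT then (1 : ℝ) else 0) := by split_ifs <;> norm_num
          linarith
      · have h0 : (0 : ℝ) ≤ (if y ∈ DT then (1 : ℝ) else 0) := by split_ifs <;> norm_num
        have h2 : (if y ∈ U₁ then (1 : ℝ) else 0) + (if y ∈ U₂ then (1 : ℝ) else 0) ≤ 1 := by
          rw [not_and_or] at hb
          rcases hb with h' | h'
          · rw [if_neg h']; split_ifs <;> norm_num
          · rw [if_neg h']; split_ifs <;> norm_num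
        linarith
    have hsum := sum_le_sum hpt
    rw [sum_sub_distrib, sum_add_distrib] at hsum
    have e1 : ∑ y ∈ U₁ ∪ U₂, (if y ∈ U₁ then (1 : ℝ) else 0) = U₁.card := by
      rw [sum_boole, filter_mem_eq_inter, inter_eq_right.2 subset_union_left]
    have e2 : ∑ y ∈ U₁ ∪ U₂, (if y ∈ U₂ then (1 : ℝ) else 0) = U₂.card := by
      rw [sum_boole, filter_mem_eq_inter, inter_eq_right.2 subset_union_right]
    have e3 : ∑ y ∈ U₁ ∪ U₂, (if y ∈ DT then (1 : ℝ) else 0) ≤ DT.card := by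
      rw [sum_boole]
      have hsubDT : ((U₁ ∪ U₂).filter fun y => y ∈ DT) ⊆ DT := fun y hy => (mem_filter.1 hy).2
      exact_mod_cast card_le_card hsubDT
    have e4 : ∑ y ∈ U₁ ∪ U₂, ((12 : ℝ) - (deg y : ℝ)) ≤ ∑ y ∈ PAY, ((12 : ℝ) - (deg y : ℝ)) :=
      sum_le_sum_of_subset_of_nonneg (union_subset hU₁P hU₂P) fun y _ _ => by
        have : (deg y : ℝ) ≤ 12 := by exact_mod_cast hdeg12 y
        linarith
    linarith
  -- every lattice exit is unsaturated-in-the-window, twin-capped, or a rim ball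
  have hLEX₁le : LEX₁.card ≤ U₁.card + TC₁.card + Rim₃.card := by
    refine (card_le_card ?_).trans ((card_union_le _ _).trans (Nat.add_le_add_right (card_union_le U₁ TC₁) _))
    intro e he
    have he' := he
    rw [hLEX₁, mem_filter] at he'
    obtain ⟨heX, heΛ, hd, hfull, hv⟩ := he'
    by_cases hrim : (ρ - 3) ^ 2 < e 0 ^ 2 + e 1 ^ 2
    · exact mem_union_right _ (mem_filter.2 ⟨heX, hrim⟩)
    refine mem_union_left _ ?_
    have hlow : -10 - 2 ≤ e 2 := by
      by_contra hlt; push Not at hlt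
      exact hrim (lowExit_rim A₁ t₁ hρ hP₁X hcell hP₁ hu₁ hsteep₁ heΛ hfull hv (by linarith))
    have hhigh : e 2 ≤ h + 10 + 2 := by
      by_contra hlt; push Not at hlt
      exact hrim (highExit_rim A₁ A₂ t₂ hρ hX hcell hP₂X' hP₂ hA₁₂ hu₁ hd hfull (by linarith))
    rcases exit_unsaturated_or_twinCap hX hs₀ hcert A₁ hu₁ hd hfull hv with h11 | htw
    · exact mem_union_left _ (mem_filter.2 ⟨he, by
        change (X.filter fun q => dist e q = 1).card ≠ 12; omega, hlow, hhigh⟩)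
    · exact mem_union_right _ (mem_filter.2 ⟨he, htw⟩)
  have hLEX₂le : LEX₂.card ≤ U₂.card + TC₂.card + Rim₃.card := by
    refine (card_le_card ?_).trans ((card_union_le _ _).trans (Nat.add_le_add_right (card_union_le U₂ TC₂) _))
    intro e he
    have he' := he
    rw [hLEX₂, mem_filter] at he'
    obtain ⟨heX, heΛ, hd, hfull, hv⟩ := he'
    by_cases hrim : (ρ - 3) ^ 2 < e 0 ^ 2 + e 1 ^ 2
    · exact mem_union_right _ (mem_filter.2 ⟨heX, hrim⟩)
    refine mem_union_left _ ?_
    have hhigh : e 2 ≤ h + 10 + 2 := by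
      by_contra hlt; push Not at hlt
      exact hrim (highExit₂_rim A₂ t₂ hρ hP₂X' hcell hP₂ hu₂ hsteep₂ heΛ hfull hv (by linarith))
    have hlow : -10 - 2 ≤ e 2 := by
      by_contra hlt; push Not at hlt
      exact hrim (lowExit₂_rim A₁ A₂ t₁ hρ hX hcell hP₁X hP₁ hA₂₁ hu₂ hd hfull (by linarith))
    rcases exit_unsaturated_or_twinCap hX hs₀ hcert A₂ hu₂ hd hfull hv with h11 | htw
    · exact mem_union_left _ (mem_filter.2 ⟨he, by
        change (X.filter fun q => dist e q = 1).card ≠ 12; omega, hlow, hhigh⟩)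
    · exact mem_union_right _ (mem_filter.2 ⟨he, htw⟩)
  -- the rim shell count
  have hRim₃ : (Rim₃.card : ℝ) ≤ 60 * (4 * 10 + 2) * (1 + h) * ρ := by
    have hsep : ∀ p ∈ Rim₃, ∀ q ∈ Rim₃, p ≠ q → 1 ≤ dist p q :=
      fun p hp q hq hpq => hX p (mem_filter.1 hp).1 q (mem_filter.1 hq).1 hpq
    have hmem : ∀ p ∈ Rim₃, -(2 * 10) ≤ p 2 ∧ p 2 ≤ h + 2 * 10 ∧ (ρ - 3) ^ 2 < p 0 ^ 2 + p 1 ^ 2 ∧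
        p 0 ^ 2 + p 1 ^ 2 ≤ ρ ^ 2 := by
      intro p hp
      obtain ⟨hpX, hpr⟩ := mem_filter.1 hp
      obtain ⟨a, b, c⟩ := hcell p hpX
      exact ⟨a, b, hpr, c⟩
    have key := card_mul_le_of_separated_in_shell Rim₃ hsep (-(2 * 10)) (h + 2 * 10) (ρ - 3) ρ (by linarith)
      (by linarith) (by linarith) hmem
    have e : (h + 2 * 10 - -(2 * 10) + 2) * (Real.pi * (ρ + 1) ^ 2 - Real.pi * (ρ - 3 - 1) ^ 2) =
        (Real.pi / 6) * (6 * (h + 4 * 10 + 2) * (10 * ρ - 15)) := by ring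
    rw [e] at key
    have hπ : 0 < Real.pi / 6 := by positivity
    have h1 : (Rim₃.card : ℝ) ≤ 6 * (h + 4 * 10 + 2) * (10 * ρ - 15) := le_of_mul_le_mul_right
      (by linarith [key]) hπ
    have h2 : h + 4 * 10 + 2 ≤ (4 * 10 + 2) * (1 + h) := by nlinarith
    have h3 : 10 * ρ - 15 ≤ 10 * ρ := by linarith
    have h4 : (0 : ℝ) ≤ h + 4 * 10 + 2 := by linarith
    nlinarith
  -- sources
  have hP₁w : ∀ p, p ∈ P₁ ↔ (p ∈ (fun q => A₁ q + t₁) '' fccStacking 1 (Real.sqrt (2 / 3)) ∧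
      (-(2 * 10)) ≤ p 2 ∧ p 2 ≤ (-(2 * 10)) + 10 ∧ p 0 ^ 2 + p 1 ^ 2 ≤ ρ ^ 2) := by
    intro p; rw [hP₁ p, show -(2 * 10) + (10 : ℝ) = -10 by ring]
  have hEX₁ := card_lattice_exits_ge_window A₁ t₁ X P₁ (-(2 * 10)) 10 ρ (by norm_num) hρ hP₁X hP₁w hu₁
  have hP₂w : ∀ p, p ∈ P₂ ↔ (p ∈ (fun q => A₂ q + t₂) '' fccStacking 1 (Real.sqrt (2 / 3)) ∧
      (h + 10) ≤ p 2 ∧ p 2 ≤ (h + 10) + 10 ∧ p 0 ^ 2 + p 1 ^ 2 ≤ ρ ^ 2) := by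
    intro p; rw [hP₂ p, show h + 10 + 10 = h + 2 * 10 by ring]
  have hEX₂ := card_lattice_exits_ge_window A₂ t₂ X P₂ (h + 10) 10 ρ (by norm_num) hρ hP₂X' hP₂w hu₂
  have hEX₁' : Real.sqrt 2 * |⟪A₁ u₁, e₃⟫_ℝ| * Real.pi * (ρ - 1) ^ 2 - 10 * Real.sqrt 2 * Real.pi * (ρ - 1) ≤
      (LEX₁.card : ℝ) := by convert hEX₁ using 3
  have hEX₂' : Real.sqrt 2 * |⟪A₂ u₂, e₃⟫_ℝ| * Real.pi * (ρ - 1) ^ 2 - 10 * Real.sqrt 2 * Real.pi * (ρ - 1) ≤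
      (LEX₂.card : ℝ) := by convert hEX₂ using 3
  have hL₁ : (LEX₁.card : ℝ) ≤ U₁.card + TC₁.card + Rim₃.card := by exact_mod_cast hLEX₁le
  have hL₂ : (LEX₂.card : ℝ) ≤ U₂.card + TC₂.card + Rim₃.card := by exact_mod_cast hLEX₂le
  -- fluxes `κᵢ ∈ [0, 2]`
  set κ₁ : ℝ := Real.sqrt 2 * |⟪A₁ u₁, e₃⟫_ℝ| with hκ₁
  set κ₂ : ℝ := Real.sqrt 2 * |⟪A₂ u₂, e₃⟫_ℝ| with hκ₂
  have hsq : 0 ≤ Real.sqrt 2 := Real.sqrt_nonneg 2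
  have hs2' : Real.sqrt 2 ≤ 2 := by
    rw [show (2 : ℝ) = Real.sqrt (2 ^ 2) by rw [Real.sqrt_sq (by norm_num)]]
    exact Real.sqrt_le_sqrt (by norm_num)
  have hκ₁0 : 0 ≤ κ₁ := mul_nonneg hsq (abs_nonneg _)
  have hκ₂0 : 0 ≤ κ₂ := mul_nonneg hsq (abs_nonneg _)
  have hκ₁2 : κ₁ ≤ 2 := by
    have := abs_inner_slot_le_one A₁ hu₁
    calc κ₁ = Real.sqrt 2 * |⟪A₁ u₁, e₃⟫_ℝ| := rfl
      _ ≤ 2 * 1 := mul_le_mul hs2' this (abs_nonneg _) (by norm_num)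
      _ = 2 := by ring
  have hκ₂2 : κ₂ ≤ 2 := by
    have := abs_inner_slot_le_one A₂ hu₂
    calc κ₂ = Real.sqrt 2 * |⟪A₂ u₂, e₃⟫_ℝ| := rfl
      _ ≤ 2 * 1 := mul_le_mul hs2' this (abs_nonneg _) (by norm_num)
      _ = 2 := by ring
  -- the two upper slab counts and the two splits
  have hD₁ := hC₁ (-(2 * 10)) (-10) (by ring) ρ hρ P₁ hP₁
  have hD₂ := hC₂ (h + 10) (h + 2 * 10) (by ring) ρ hρ P₂ hP₂
  have hsplit₁ := contactDeficiency_sdiff_split hP₁X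
  have hsplit₂ := contactDeficiency_sdiff_split hP₂X
  have htwo := two_mul_contactDeficiency_eq_sum X
  -- constants
  have hb : C₁ * ρ ≤ |C₁| * (1 + h) * ρ := by
    have h1 : 0 ≤ (|C₁| - C₁) * ρ := mul_nonneg (by linarith only [le_abs_self C₁]) hρ0
    have h2 : 0 ≤ |C₁| * h * ρ := by positivity
    linarith only [h1, h2]
  have hc' : C₂ * ρ ≤ |C₂| * (1 + h) * ρ := by
    have h1 : 0 ≤ (|C₂| - C₂) * ρ := mul_nonneg (by linarith only [le_abs_self C₂]) hρ0
    have h2 : 0 ≤ |C₂| * h * ρ := by positivity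
    linarith only [h1, h2]
  have hπ : Real.pi ≤ 4 := Real.pi_le_four
  have hπ0 : 0 ≤ Real.pi := Real.pi_pos.le
  have hkey : ∀ κ : ℝ, 0 ≤ κ → κ ≤ 2 →
      κ * Real.pi * ρ ^ 2 - 100 * (1 + h) * ρ ≤ κ * Real.pi * (ρ - 1) ^ 2 - 10 * Real.sqrt 2 * Real.pi * (ρ - 1) := by
    intro κ hκ0 hκ2
    have e : κ * Real.pi * (ρ - 1) ^ 2 - 10 * Real.sqrt 2 * Real.pi * (ρ - 1) - (κ * Real.pi * ρ ^ 2 - 100 * (1 + h) * ρ)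
        = (100 * ρ - 2 * (κ * Real.pi * ρ) - 10 * (Real.sqrt 2 * Real.pi * ρ)) + 100 * (h * ρ) + κ * Real.pi +
          10 * (Real.sqrt 2 * Real.pi) := by ring
    have h1 : 0 ≤ h * ρ := mul_nonneg hh hρ0
    have h2 : 0 ≤ Real.sqrt 2 * Real.pi := mul_nonneg hsq hπ0
    have h3 : κ * Real.pi * ρ ≤ 8 * ρ := by
      have : κ * Real.pi ≤ 2 * 4 := mul_le_mul hκ2 hπ hπ0 (by norm_num)
      exact (mul_le_mul_of_nonneg_right this hρ0).trans (by linarith)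
    have h4 : Real.sqrt 2 * Real.pi * ρ ≤ 8 * ρ := by
      have : Real.sqrt 2 * Real.pi ≤ 8 := by nlinarith only [hπ, hπ0, hsq, hs2']
      exact mul_le_mul_of_nonneg_right this hρ0
    have h5 : 0 ≤ κ * Real.pi := mul_nonneg hκ0 hπ0
    linarith only [e, h1, h2, h3, h4, h5, hρ0]
  have hkey₁ := hkey κ₁ hκ₁0 hκ₁2
  have hkey₂ := hkey κ₂ hκ₂0 hκ₂2
  have hhρ : 0 ≤ h * ρ := mul_nonneg hh hρ0
  linarith only [hled, hEX₁', hEX₂', hPAYge, hL₁, hL₂, hRim₃, hD₁, hD₂, hsplit₁, hsplit₂, htwo, hb, hc', hkey₁,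
    hkey₂, hρ0, hh, hhρ, hπ0]

end Summit.Ventures.Crystal3D.Theorems

end
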